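import Summits.QuantumAdvantage.QuantumAdvantage.Theorems.CharDialTokenDialA2
import HarnessLib


/-!
# CharDial tower — the TOKEN DIAL, part A: the private-token pairing at a dead adjacency (engine)

Cell `decomp-qadv`, lens 6 («barrier-complement carving»), generation 19; supports the LOW child
`JLinLowResidual5` (stmt-QuantumAdvantage-27206) and the HIGH child `JLinResidualHigh5` (27207) of the CharDial crux
`WalkHardFJLinOdd` (32604).

THE MOVE.  At an adjacent pair of positions `(s, t = s+1)` the ADJACENT TRANSPOSITION of an input `u` with `u_s ≠ u_t`
(= `SegMove.segCompl u s (s+2)`, complementing both bits) preserves the Hamming weight and every prefix weight except the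
one read by the cut numbered `t` (the cut between the two positions), which moves by `±1`; hence every cut's address
`(c + g + walkExp u g) mod 3` is unchanged except the address of cut `t`, which moves by `±1 (mod 3)`
(`walkExp_swap_of_ne`, `addr_swap_at`).  If the pair is DEAD for a junta ⊕ `𝔽_p`-form presentation — every cut has
`a_g(s) = a_g(t)` and `s, t ∉ J_g` — then no decision changes (`SegMove.cut_swap_insensitive`), so the win bit flips
exactly on the inputs accepted by cut `t` at which cut `t` is live before XOR after the swap (`ringWinU_swap_ne`), and the
abstract pairing law (`SegMove.pairing_law`) turns that set `tokE` into `≥ |tokE|/2` losers (`tok_pairing`).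
This is a PERMUTATION move, not a freeze move: it lies outside the technique class of the freeze-all-forms ceiling
(g18 NODE §3) by construction.

THE COUNT.  `|tokE| ≥ (2/3)·#{u : u_s ≠ u_t, cut t accepts u} − (small)`: on every cell
{junta bits of cut `t` and the pattern `(u_s,u_t)` fixed, form value fixed} the address of cut `t` is within `2(2cos(π/3p))ⁿ`
of uniform over `ℤ/3` — after complementing the coordinates `< t` the address becomes `c + wt` (mod 3) and the cell stays a
cell of linear forms mod `p`, so this IS the Literature's two-moduli lemma
`TwoModuli.abs_three_mul_card_cell_sub_card_le` ([ChattopadhyayWigderson2009, Lemma 5]; `3 ∤ p`).  Main result of this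
part: the explicit ENGINE INEQUALITY `engine`:
`3·#WIN_c + #{u : u_s ≠ u_t ∧ y_t(u)} ≤ 3·2ⁿ + 8p·2^{|J_t|}·(2cos(π/(3p)))ⁿ`.
Part B turns it into the dial theorem (class `TokenHyp`, `θ = 1 − 1/(24p)`), part C into the tower junction.

WHAT THIS IS NOT: nothing about adjacencies felt by some cut (positive sensitivity) — that is the open LOW programme.  0 sorry.
SPLIT NOTE (writer g11, gate line limit): §1–§3 live in part A1, §4 in part A2 (imported); this file keeps §5, the engine.
-/

set_option autoImplicit false

namespace Summit.QuantumAdvantage.AdviceFreeQNC0.JLinPeel.TokenDial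

open Finset SegMove

variable {n : ℕ}

/-! ### §5 the engine inequality -/

section Engine

variable {p : ℕ} [hp : Fact p.Prime]

/-- the Boolean pattern of a subset. -/
def patt (T : Finset (Fin n)) : Fin n → Bool := fun j => decide (j ∈ T)

omit hp in
/-- a presentation's form IS the `SegMove.form` of its coefficient vector (`rfl`). -/
theorem strat_eq (D : JLinData p n) (g : Fin (n + 1)) (u : Fin n → Bool) :
    D.strat g u = D.h g u (form (D.a g) u) := rfl

omit hp in
/-- on a cell whose pattern set contains the junta, the table of the cut is the table at the pattern. -/
theorem table_on_cell (D : JLinData p n) (g : Fin (n + 1)) (O : Finset (Fin n)) (hJO : D.J g ⊆ O)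
    (T : Finset (Fin n)) (u : Fin n → Bool) (hu : ∀ j ∈ O, u j = patt T j) (x : ZMod p) :
    D.h g u x = D.h g (patt T) x :=
  D.hJ g u (patt T) (fun i hi => hu i (hJO hi)) x

omit hp in
/-- the pattern set of an input on `O` reproduces the input on `O`. -/
theorem patt_filter (O : Finset (Fin n)) (u : Fin n → Bool) :
    ∀ j ∈ O, u j = patt (O.filter fun j => u j = true) j := by
  intro j hj
  unfold patt
  rcases Bool.eq_false_or_eq_true (u j) with h | h <;> simp [mem_filter, h, hj]

omit hp in
/-- **dead pairs are dead for the strategy**: no cut's output feels the transposition on the swap set. -/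
theorem dead_strat (D : JLinData p n) (s t : Fin n) (hst : t.val = s.val + 1)
    (hdead : ∀ g, D.a g s = D.a g t ∧ s ∉ D.J g ∧ t ∉ D.J g) (g : Fin (n + 1)) (u : Fin n → Bool)
    (hne : u s ≠ u t) : D.strat g (segCompl u s.val (s.val + 2)) = D.strat g u := by
  rw [strat_eq, strat_eq]
  exact cut_swap_insensitive (D.J g) (D.a g) (D.h g) (D.hJ g) u s t hst hne (hdead g).1 (hdead g).2.1 (hdead g).2.2

/-- the index set of the relevant cells: patterns on `O` with `u_s ≠ u_t` and form values ACCEPTED by cut `g`. -/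
def idx (D : JLinData p n) (g : Fin (n + 1)) (O : Finset (Fin n)) (s t : Fin n) : Finset (Finset (Fin n) × ZMod p) :=
  (O.powerset ×ˢ (univ : Finset (ZMod p))).filter fun Tv => patt Tv.1 s ≠ patt Tv.1 t ∧ D.h g (patt Tv.1) Tv.2 = true

/-- membership in `idx`. -/
theorem mem_idx (D : JLinData p n) (g : Fin (n + 1)) (O : Finset (Fin n)) (s t : Fin n) (Tv : Finset (Fin n) × ZMod p) :
    Tv ∈ idx D g O s t ↔ Tv.1 ⊆ O ∧ patt Tv.1 s ≠ patt Tv.1 t ∧ D.h g (patt Tv.1) Tv.2 = true := by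
  unfold idx
  rw [mem_filter, mem_product, mem_powerset]
  simp only [mem_univ, and_true]

/-- the size of the index set. -/
theorem card_idx_le (D : JLinData p n) (g : Fin (n + 1)) (O : Finset (Fin n)) (s t : Fin n) :
    (idx D g O s t).card ≤ 2 ^ O.card * p := by
  unfold idx
  refine (card_filter_le _ _).trans ?_
  rw [card_product, card_powerset, card_univ, ZMod.card]

/-- **(R ⊆ ⋃ cells)** the accepted swap-set inputs are covered by the relevant cells. -/
theorem rset_subset (D : JLinData p n) (g : Fin (n + 1)) (O : Finset (Fin n)) (hJO : D.J g ⊆ O) (s t : Fin n)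
    (hsO : s ∈ O) (htO : t ∈ O) :
    (univ.filter fun u : Fin n → Bool => u s ≠ u t ∧ D.strat g u = true) ⊆
      (idx D g O s t).biUnion fun Tv => cell O (patt Tv.1) (D.a g) Tv.2 := by
  intro u hu
  rw [mem_filter] at hu
  obtain ⟨-, hne, hacc⟩ := hu
  rw [mem_biUnion]
  have hpat := patt_filter O u
  refine ⟨(O.filter fun j => u j = true, form (D.a g) u), ?_, ?_⟩
  · rw [mem_idx]
    refine ⟨filter_subset _ _, ?_, ?_⟩
    · rw [← hpat s hsO, ← hpat t htO]; exact hne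
    · rw [← table_on_cell D g O hJO _ u hpat, ← strat_eq]; exact hacc
  · rw [mem_cell]
    exact ⟨hpat, rfl⟩

/-- the address class forcing a flip AFTER the swap: `1` if `u_s = 1`, `2` if `u_s = 0`. -/
def rflip (T : Finset (Fin n)) (s : Fin n) : ℕ := if s ∈ T then 1 else 2

omit hp in
/-- the flip residue `rflip T s` is `< 3`. -/
theorem rflip_lt (T : Finset (Fin n)) (s : Fin n) : rflip T s < 3 := by
  unfold rflip; split_ifs <;> omega

omit hp in
/-- the flip residue `rflip T s` is nonzero. -/
theorem rflip_ne_zero (T : Finset (Fin n)) (s : Fin n) : rflip T s ≠ 0 := by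
  unfold rflip; split_ifs <;> omega

/-- the flip part of a cell: address `0` now or address `0` after the swap. -/
def flipCell (c : ℕ) (O : Finset (Fin n)) (a : Fin n → ZMod p) (s t : Fin n) (Tv : Finset (Fin n) × ZMod p) :
    Finset (Fin n → Bool) :=
  (cell O (patt Tv.1) a Tv.2).filter fun u => addr c u t.val = 0 ∨ addr c u t.val = rflip Tv.1 s

/-- **(⋃ flip cells ⊆ tokE)** -/
theorem flipCell_subset_tokE (c : ℕ) (D : JLinData p n) (s t : Fin n) (hst : t.val = s.val + 1) (O : Finset (Fin n))
    (hJO : D.J (cut t) ⊆ O) (hsO : s ∈ O) (htO : t ∈ O) (Tv : Finset (Fin n) × ZMod p) (hTv : Tv ∈ idx D (cut t) O s t) :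
    flipCell c O (D.a (cut t)) s t Tv ⊆ tokE c D.strat s t := by
  intro u hu
  unfold flipCell at hu
  rw [mem_filter, mem_cell] at hu
  obtain ⟨⟨hpat, hform⟩, haddr⟩ := hu
  rw [mem_idx] at hTv
  obtain ⟨-, hne, hacc⟩ := hTv
  have hne' : u s ≠ u t := by rw [hpat s hsO, hpat t htO]; exact hne
  rw [mem_tokE]
  refine ⟨hne', by rw [strat_eq, table_on_cell D (cut t) O hJO _ u hpat, hform]; exact hacc, ?_⟩
  rcases haddr with h | h
  · exact Or.inl h
  · right
    have hshift := addr_swap_at c u s t hst hne'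
    rw [← hst] at hshift
    rw [hshift, h]
    have hus : u s = patt Tv.1 s := hpat s hsO
    unfold rflip
    unfold patt at hus
    by_cases hs : s ∈ Tv.1 <;> simp [hs] at hus <;> simp [hs, hus]

omit hp in
/-- distinct relevant cells are disjoint. -/
theorem cell_disjoint (O : Finset (Fin n)) (a : Fin n → ZMod p) {T T' : Finset (Fin n)} (hT : T ⊆ O) (hT' : T' ⊆ O)
    {v v' : ZMod p} (hne : (T, v) ≠ (T', v')) : Disjoint (cell O (patt T) a v) (cell O (patt T') a v') := by
  rw [disjoint_left]
  intro u hu hu'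
  rw [mem_cell] at hu hu'
  apply hne
  have hTT : T = T' := by
    ext j
    by_cases hj : j ∈ O
    · have h1 := hu.1 j hj
      have h2 := hu'.1 j hj
      unfold patt at h1 h2
      rw [h1] at h2
      simpa using h2
    · exact ⟨fun h => absurd (hT h) hj, fun h => absurd (hT' h) hj⟩
  rw [hTT, ← hu.2, ← hu'.2]

/-- **(counting the flip cells)** `Σ_{relevant cells} (#addr-0 part + #addr-rflip part) ≤ |tokE|`. -/
theorem sum_flip_le_tokE (c : ℕ) (D : JLinData p n) (s t : Fin n) (hst : t.val = s.val + 1) (O : Finset (Fin n))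
    (hJO : D.J (cut t) ⊆ O) (hsO : s ∈ O) (htO : t ∈ O) :
    ∑ Tv ∈ idx D (cut t) O s t,
        (((cell O (patt Tv.1) (D.a (cut t)) Tv.2).filter fun u => addr c u t.val = 0).card +
          ((cell O (patt Tv.1) (D.a (cut t)) Tv.2).filter fun u => addr c u t.val = rflip Tv.1 s).card)
      ≤ (tokE c D.strat s t).card := by
  classical
  have hsum : ∀ Tv ∈ idx D (cut t) O s t,
      ((cell O (patt Tv.1) (D.a (cut t)) Tv.2).filter fun u => addr c u t.val = 0).card +
        ((cell O (patt Tv.1) (D.a (cut t)) Tv.2).filter fun u => addr c u t.val = rflip Tv.1 s).card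
      = (flipCell c O (D.a (cut t)) s t Tv).card := by
    intro Tv _
    unfold flipCell
    rw [filter_or, card_union_of_disjoint]
    rw [disjoint_filter]
    intro u _ h0 h1
    exact rflip_ne_zero Tv.1 s (by omega)
  rw [sum_congr rfl hsum, ← card_biUnion]
  · exact card_le_card (biUnion_subset.2 fun Tv hTv => flipCell_subset_tokE c D s t hst O hJO hsO htO Tv hTv)
  · intro Tv hTv Tv' hTv' hne
    have h1 := ((mem_idx D (cut t) O s t Tv).1 hTv).1
    have h2 := ((mem_idx D (cut t) O s t Tv').1 hTv').1
    unfold flipCell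
    exact disjoint_filter_filter (cell_disjoint O (D.a (cut t)) h1 h2 (by
      intro h; apply hne; exact Prod.ext (congrArg Prod.fst h) (congrArg Prod.snd h)))

/-- ★ **THE ENGINE INEQUALITY.** for a junta ⊕ `𝔽_p`-form presentation with a DEAD adjacent pair `(s, t = s+1)`
(`3 ∤ p`): `3·#WIN_c + #{u : u_s ≠ u_t ∧ cut t accepts u} ≤ 3·2ⁿ + 8p·2^{|J_t|}·(2cos(π/(3p)))ⁿ`. -/
theorem engine (hp3 : p ≠ 3) (c : ℕ) (D : JLinData p n) (s t : Fin n) (hst : t.val = s.val + 1)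
    (hdead : ∀ g, D.a g s = D.a g t ∧ s ∉ D.J g ∧ t ∉ D.J g) :
    3 * ((univ.filter fun u : Fin n → Bool => ringWinU c D.strat u = true).card : ℝ)
      + ((univ.filter fun u : Fin n → Bool => u s ≠ u t ∧ D.strat (cut t) u = true).card : ℝ)
      ≤ 3 * (2 : ℝ) ^ n + 8 * p * (2 : ℝ) ^ (D.J (cut t)).card * (2 * Real.cos (Real.pi / (3 * p))) ^ n := by
  classical
  set O : Finset (Fin n) := insert s (insert t (D.J (cut t))) with hO
  have hJO : D.J (cut t) ⊆ O := fun i hi => by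
    rw [hO]; exact mem_insert_of_mem (mem_insert_of_mem hi)
  have hsO : s ∈ O := by rw [hO]; exact mem_insert_self _ _
  have htO : t ∈ O := by rw [hO]; exact mem_insert_of_mem (mem_insert_self _ _)
  have hOcard : O.card ≤ (D.J (cut t)).card + 2 := by
    rw [hO]
    exact (card_insert_le _ _).trans (by have := card_insert_le t (D.J (cut t)); omega)
  set err : ℝ := 2 * (2 * Real.cos (Real.pi / (3 * p))) ^ n with herr
  -- (1) the pairing inequality
  have hpair := tok_pairing c D.strat s t hst (fun g u hne => dead_strat D s t hst hdead g u hne)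
  -- (2) the accepted swap-set inputs are covered by the relevant cells
  have hR : ((univ.filter fun u : Fin n → Bool => u s ≠ u t ∧ D.strat (cut t) u = true).card : ℝ)
      ≤ ∑ Tv ∈ idx D (cut t) O s t, ((cell O (patt Tv.1) (D.a (cut t)) Tv.2).card : ℝ) := by
    have h := (card_le_card (rset_subset D (cut t) O hJO s t hsO htO)).trans card_biUnion_le
    exact_mod_cast h
  -- (3) the flip cells fit into tokE
  have hE := sum_flip_le_tokE c D s t hst O hJO hsO htO
  -- (4) per cell: two thirds, up to err each
  have hcell : ∀ Tv ∈ idx D (cut t) O s t,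
      2 * ((cell O (patt Tv.1) (D.a (cut t)) Tv.2).card : ℝ) ≤
        3 * ((((cell O (patt Tv.1) (D.a (cut t)) Tv.2).filter fun u => addr c u t.val = 0).card +
          ((cell O (patt Tv.1) (D.a (cut t)) Tv.2).filter fun u => addr c u t.val = rflip Tv.1 s).card : ℕ) : ℝ)
        + 2 * err := by
    intro Tv _
    have h0 := cell_le_three_addr hp3 c O (patt Tv.1) (D.a (cut t)) Tv.2 t 0 (by omega)
    have h1 := cell_le_three_addr hp3 c O (patt Tv.1) (D.a (cut t)) Tv.2 t (rflip Tv.1 s) (rflip_lt _ _)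
    push_cast at h0 h1 ⊢
    linarith
  have hsum := sum_le_sum hcell
  rw [← mul_sum, sum_add_distrib, ← mul_sum, sum_const, nsmul_eq_mul] at hsum
  -- (5) sizes
  have hidx : ((idx D (cut t) O s t).card : ℝ) ≤ 4 * (2 : ℝ) ^ (D.J (cut t)).card * p := by
    have h := card_idx_le D (cut t) O s t
    have h2 : (2 : ℕ) ^ O.card ≤ 2 ^ ((D.J (cut t)).card + 2) := Nat.pow_le_pow_right (by norm_num) hOcard
    have h3 : (idx D (cut t) O s t).card ≤ 2 ^ ((D.J (cut t)).card + 2) * p := h.trans (Nat.mul_le_mul_right _ h2)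
    have h4 : ((idx D (cut t) O s t).card : ℝ) ≤ ((2 ^ ((D.J (cut t)).card + 2) * p : ℕ) : ℝ) := by exact_mod_cast h3
    refine h4.trans (le_of_eq ?_)
    push_cast
    ring
  have herr0 : 0 ≤ err := by
    rw [herr]
    have hcos : 0 ≤ Real.cos (Real.pi / (3 * p)) := by
      apply Real.cos_nonneg_of_neg_pi_div_two_le_of_le
      · have : 0 ≤ Real.pi / (3 * p) := by positivity
        linarith [Real.pi_pos]
      · rw [div_le_div_iff₀ (by have := hp.out.pos; positivity) (by norm_num)]
        have : (2 : ℝ) ≤ p := by exact_mod_cast hp.out.two_le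
        nlinarith [Real.pi_pos]
    positivity
  have hpairR : 2 * ((univ.filter fun u : Fin n → Bool => ringWinU c D.strat u = true).card : ℝ)
      + ((tokE c D.strat s t).card : ℝ) ≤ 2 * (2 : ℝ) ^ n := by exact_mod_cast hpair
  have hER : ((∑ Tv ∈ idx D (cut t) O s t,
      (((cell O (patt Tv.1) (D.a (cut t)) Tv.2).filter fun u => addr c u t.val = 0).card +
        ((cell O (patt Tv.1) (D.a (cut t)) Tv.2).filter fun u => addr c u t.val = rflip Tv.1 s).card) : ℕ) : ℝ)
      ≤ ((tokE c D.strat s t).card : ℝ) := by exact_mod_cast hE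
  push_cast at hER hsum
  have hmul : ((idx D (cut t) O s t).card : ℝ) * (2 * err) ≤ 4 * (2 : ℝ) ^ (D.J (cut t)).card * p * (2 * err) :=
    mul_le_mul_of_nonneg_right hidx (by linarith)
  rw [herr] at hmul
  nlinarith [hR, hsum, hER, hpairR, hmul, herr0]

end Engine


end Summit.QuantumAdvantage.AdviceFreeQNC0.JLinPeel.TokenDial
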